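import Mathlib
import HarnessLib

/-!
# `WakeRatchet.TailRatchet` (stmt-NavierStokesRegularity-21808): the DRAIN-FREE front equation is an
# initial-value problem at `0⁻` — uniqueness of bounded solutions of `b' = (4/s²) b(t/s)²` given `b(0⁻)`

Support file for the crux `TailRatchet` (route `WakeRatchet`; MODEL lattice ODEs of Tao 2016 §1.2, §4 —
nothing in this file is a statement about the Navier–Stokes equations, and no item is closed here).

Context (census of stmt-21808, continuation programme "R-glob", step G0 «drain-free rigidity»).  The lacunary
branch of exact scalar dyadic DSS fronts (`…RelayFront`, `…LacunaryFront`) emanates from the relay point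
`(s, δ) = (2, 0)` of the front equation `b' = (4/s²)b(t/s)² − 4sδ·b(t)b(st)`.  A global continuation of the
branch to `δ → 1⁻` (`Λ → 1⁺`, the end that would refute `TailRatchet`) must rule out a return to the
drain-free axis `δ = 0` at a time ratio `s ≠ 2`.  The drain-free equation `b' = (4/s²) b(t/s)²` only looks
ahead (`t/s ∈ (t, 0)`), so it is an INITIAL-VALUE PROBLEM AT `0⁻` of pantograph type:

* `drainfree_sub_hasDerivAt` — the difference `d = b₁ − b₂` of two solutions solves the linear pantograph-type
  equation `d' = (4/s²)(b₁(t/s) + b₂(t/s))·d(t/s)`;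
* `drainfree_eq_near`, `drainfree_eq_scale`, `drainfree_eq_pow` — vanishing of `d` near `0⁻` (maximum
  argument on `[−τ₀, 0]`, `τ₀ = s²/(16(B+1))`) and its propagation `[−τ,0] ↦ [−sτ, 0]`;
* `drainfree_ivp_unique` — two solutions on `t < 0`, continuous on `(−∞, 0]`, bounded by `B` there, with
  the same value at `0`, COINCIDE on `(−∞, 0]` (any `s > 1`).

Consequently the drain-free fronts at time ratio `s` are, up to the scaling symmetry `b ↦ c·b(c·)`, the
single solution with `b(0⁻) = 1`; whether it is an admissible front (positive, integrable) is a property of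
`s` alone.  NUMERICAL RECORD (not used; session script `work/drainfree.py` of the census, backward RK2 from
`b(0)=1`): `s < 2` — positive with the non-integrable tail `b ≈ 1/(4|t|)` (`b(−10), b(−20), b(−40) =
0.0250, 0.0125, 0.0063` at `s = 1.3`); `s = 2` — `e^{t}`; `s > 2` — sign change (first zero at
`t ≈ −4.8, −3.7, −3.5, −3.9, −5.7` for `s = 2.05, 2.2, 2.5, 3, 4`).  So `s = 2` appears to be the ONLY
drain-free time ratio carrying an admissible front (G0); the analytic proof of the two tail statements is open.

HONEST FRAMING: elementary real analysis of a MODEL functional ODE; the construction item and the crux stay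
open; nothing here concerns Navier–Stokes.
-/

noncomputable section

set_option linter.dupNamespace false

namespace Summit.NavierStokesRegularity.NavierStokesRegularity.Theorems

namespace WakeRatchetRelayDrainFreeUnique

open Set Filter Topology

variable {s B : ℝ} {b₁ b₂ : ℝ → ℝ}

/-- The difference of two drain-free solutions solves `d' = (4/s²)(b₁(t/s)+b₂(t/s))·d(t/s)`. [folklore] -/
theorem drainfree_sub_hasDerivAt
    (hd₁ : ∀ t : ℝ, t < 0 → HasDerivAt b₁ (4 / s ^ 2 * b₁ (t / s) ^ 2) t)
    (hd₂ : ∀ t : ℝ, t < 0 → HasDerivAt b₂ (4 / s ^ 2 * b₂ (t / s) ^ 2) t) (t : ℝ) (ht : t < 0) :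
    HasDerivAt (fun x => b₁ x - b₂ x)
      (4 / s ^ 2 * (b₁ (t / s) + b₂ (t / s)) * (b₁ (t / s) - b₂ (t / s))) t := by
  refine ((hd₁ t ht).sub (hd₂ t ht)).congr_deriv ?_
  ring

/-- **Smallness step.**  For `s > 1`, two drain-free solutions continuous on `(−∞,0]`, bounded by `B` there
and equal at `0` coincide on `[−τ₀, 0]`, `τ₀ = s²/(16(B+1))`. [folklore] -/
theorem drainfree_eq_near (hs : 1 < s) (hB : 0 ≤ B)
    (hc₁ : ContinuousOn b₁ (Iic 0)) (hc₂ : ContinuousOn b₂ (Iic 0))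
    (hd₁ : ∀ t : ℝ, t < 0 → HasDerivAt b₁ (4 / s ^ 2 * b₁ (t / s) ^ 2) t)
    (hd₂ : ∀ t : ℝ, t < 0 → HasDerivAt b₂ (4 / s ^ 2 * b₂ (t / s) ^ 2) t)
    (hB₁ : ∀ t : ℝ, t ≤ 0 → |b₁ t| ≤ B) (hB₂ : ∀ t : ℝ, t ≤ 0 → |b₂ t| ≤ B) (h0 : b₁ 0 = b₂ 0) :
    ∀ t ∈ Icc (-(s ^ 2 / (16 * (B + 1)))) 0, b₁ t = b₂ t := by
  have hs0 : 0 < s := by linarith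
  set τ₀ : ℝ := s ^ 2 / (16 * (B + 1)) with hτ₀
  have hτ₀pos : 0 < τ₀ := by positivity
  set d : ℝ → ℝ := fun x => b₁ x - b₂ x with hd_def
  have hdc : ContinuousOn d (Iic 0) := hc₁.sub hc₂
  have hd0 : d 0 = 0 := by simp [hd_def, h0]
  have hsub : Icc (-τ₀) 0 ⊆ Iic (0 : ℝ) := Icc_subset_Iic_self
  have hcont' : ContinuousOn (fun t => |d t|) (Icc (-τ₀) 0) :=
    continuous_abs.comp_continuousOn (hdc.mono hsub)
  obtain ⟨tm, htm, hmax⟩ := isCompact_Icc.exists_isMaxOn (nonempty_Icc.2 (by linarith)) hcont'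
  rw [isMaxOn_iff] at hmax
  set M := |d tm| with hM_def
  have hM0 : 0 ≤ M := abs_nonneg _
  -- `|d'| ≤ (8B/s²) M` on the interval, hence `|d| ≤ M/2`
  have key : ∀ t ∈ Icc (-τ₀) 0, |d t| ≤ M / 2 := by
    intro t ht
    rcases ht.2.eq_or_lt with rfl | htlt
    · rw [hd0, abs_zero]; positivity
    have hc : ContinuousOn d (Icc t 0) := hdc.mono Icc_subset_Iic_self
    have hd : ∀ x ∈ Ico t 0, HasDerivWithinAt d
        (4 / s ^ 2 * (b₁ (x / s) + b₂ (x / s)) * (b₁ (x / s) - b₂ (x / s))) (Ici x) x :=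
      fun x hx => (drainfree_sub_hasDerivAt hd₁ hd₂ x hx.2).hasDerivWithinAt
    have hb : ∀ x ∈ Ico t 0, ‖4 / s ^ 2 * (b₁ (x / s) + b₂ (x / s)) * (b₁ (x / s) - b₂ (x / s))‖ ≤
        8 * B / s ^ 2 * M := by
      intro x hx
      have hxs0 : x / s ≤ 0 := div_nonpos_of_nonpos_of_nonneg hx.2.le hs0.le
      have hxs : x / s ∈ Icc (-τ₀) 0 := by
        refine ⟨?_, hxs0⟩
        have h1 : -τ₀ ≤ x := le_trans ht.1 hx.1
        have h2 : x ≤ x / s := by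
          rw [le_div_iff₀ hs0]; nlinarith [hx.2]
        linarith
      have hsum : |b₁ (x / s) + b₂ (x / s)| ≤ 2 * B :=
        (abs_add_le _ _).trans (by linarith [hB₁ _ hxs0, hB₂ _ hxs0])
      have hdx : |b₁ (x / s) - b₂ (x / s)| ≤ M := hmax _ hxs
      rw [Real.norm_eq_abs, abs_mul, abs_mul, abs_of_pos (by positivity : (0 : ℝ) < 4 / s ^ 2)]
      calc 4 / s ^ 2 * |b₁ (x / s) + b₂ (x / s)| * |b₁ (x / s) - b₂ (x / s)| ≤ 4 / s ^ 2 * (2 * B) * M :=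
          mul_le_mul (mul_le_mul_of_nonneg_left hsum (by positivity)) hdx (abs_nonneg _) (by positivity)
        _ = 8 * B / s ^ 2 * M := by ring
    have hmv := norm_image_sub_le_of_norm_deriv_right_le_segment hc hd hb 0 ⟨htlt.le, le_rfl⟩
    rw [hd0, zero_sub, norm_neg, Real.norm_eq_abs] at hmv
    have hτB : 8 * B / s ^ 2 * τ₀ ≤ 1 / 2 := by
      rw [hτ₀, div_mul_div_comm, div_le_iff₀ (by positivity)]
      nlinarith [sq_nonneg s]
    calc |d t| ≤ 8 * B / s ^ 2 * M * (0 - t) := hmv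
      _ ≤ 8 * B / s ^ 2 * M * τ₀ := mul_le_mul_of_nonneg_left (by linarith [ht.1]) (by positivity)
      _ = (8 * B / s ^ 2 * τ₀) * M := by ring
      _ ≤ 1 / 2 * M := mul_le_mul_of_nonneg_right hτB hM0
      _ = M / 2 := by ring
  have hMle : M ≤ M / 2 := key tm htm
  have hM : M = 0 := le_antisymm (by linarith) hM0
  intro t ht
  have := key t ht
  rw [hM, zero_div] at this
  have h1 : d t = 0 := abs_eq_zero.1 (le_antisymm this (abs_nonneg _))
  simpa [hd_def, sub_eq_zero] using h1

/-- **Continuation step.**  If the two solutions agree on `[−τ, 0]` (`τ ≥ 0`), they agree on `[−sτ, 0]`: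
on `[−sτ, −τ]` the right-hand sides only see `[−τ, 0)`. [folklore] -/
theorem drainfree_eq_scale (hs : 1 < s)
    (hc₁ : ContinuousOn b₁ (Iic 0)) (hc₂ : ContinuousOn b₂ (Iic 0))
    (hd₁ : ∀ t : ℝ, t < 0 → HasDerivAt b₁ (4 / s ^ 2 * b₁ (t / s) ^ 2) t)
    (hd₂ : ∀ t : ℝ, t < 0 → HasDerivAt b₂ (4 / s ^ 2 * b₂ (t / s) ^ 2) t)
    {τ : ℝ} (hτ : 0 ≤ τ) (hz : ∀ t ∈ Icc (-τ) 0, b₁ t = b₂ t) :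
    ∀ t ∈ Icc (-(s * τ)) 0, b₁ t = b₂ t := by
  have hs0 : 0 < s := by linarith
  intro t ht
  by_cases hcase : -τ ≤ t
  · exact hz t ⟨hcase, ht.2⟩
  · rw [not_le] at hcase
    set d : ℝ → ℝ := fun x => b₁ x - b₂ x with hd_def
    have hτ0 : d (-τ) = 0 := by
      have := hz (-τ) ⟨le_rfl, by linarith⟩
      simp [hd_def, this]
    have hc : ContinuousOn d (Icc t (-τ)) :=
      (hc₁.sub hc₂).mono (Icc_subset_Iic_iff hcase.le |>.2 (by linarith))
    -- on `[t, −τ)` the derivative of `d` vanishes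
    have hd : ∀ x ∈ Ico t (-τ), HasDerivWithinAt d 0 (Ici x) x := by
      intro x hx
      have hx0 : x < 0 := lt_of_lt_of_le hx.2 (by linarith)
      have hxs : x / s ∈ Icc (-τ) 0 := by
        refine ⟨?_, div_nonpos_of_nonpos_of_nonneg hx0.le hs0.le⟩
        rw [le_div_iff₀ hs0]
        have : -(s * τ) ≤ x := le_trans ht.1 hx.1
        linarith
      have heq : b₁ (x / s) = b₂ (x / s) := hz _ hxs
      have := drainfree_sub_hasDerivAt hd₁ hd₂ x hx0
      rw [heq, sub_self, mul_zero] at this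
      exact this.hasDerivWithinAt
    have hb : ∀ x ∈ Ico t (-τ), ‖(0 : ℝ)‖ ≤ 0 := fun _ _ => by simp
    have hmv := norm_image_sub_le_of_norm_deriv_right_le_segment hc hd hb (-τ) ⟨hcase.le, le_rfl⟩
    rw [hτ0, zero_sub, norm_neg, Real.norm_eq_abs] at hmv
    have h1 : |d t| ≤ 0 := hmv.trans (by simp)
    have h2 : d t = 0 := abs_eq_zero.1 (le_antisymm h1 (abs_nonneg _))
    simpa [hd_def, sub_eq_zero] using h2

/-- Iterated continuation: agreement on `[−sⁿτ₀, 0]` for every `n`. [folklore] -/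
theorem drainfree_eq_pow (hs : 1 < s) (hB : 0 ≤ B)
    (hc₁ : ContinuousOn b₁ (Iic 0)) (hc₂ : ContinuousOn b₂ (Iic 0))
    (hd₁ : ∀ t : ℝ, t < 0 → HasDerivAt b₁ (4 / s ^ 2 * b₁ (t / s) ^ 2) t)
    (hd₂ : ∀ t : ℝ, t < 0 → HasDerivAt b₂ (4 / s ^ 2 * b₂ (t / s) ^ 2) t)
    (hB₁ : ∀ t : ℝ, t ≤ 0 → |b₁ t| ≤ B) (hB₂ : ∀ t : ℝ, t ≤ 0 → |b₂ t| ≤ B) (h0 : b₁ 0 = b₂ 0) (n : ℕ) :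
    ∀ t ∈ Icc (-(s ^ n * (s ^ 2 / (16 * (B + 1))))) 0, b₁ t = b₂ t := by
  induction n with
  | zero =>
    simpa only [pow_zero, one_mul] using drainfree_eq_near hs hB hc₁ hc₂ hd₁ hd₂ hB₁ hB₂ h0
  | succ n ih =>
    have h2 : s ^ (n + 1) * (s ^ 2 / (16 * (B + 1))) = s * (s ^ n * (s ^ 2 / (16 * (B + 1)))) := by
      rw [pow_succ]; ring
    rw [h2]
    exact drainfree_eq_scale hs hc₁ hc₂ hd₁ hd₂ (by positivity) ih

/-- **UNIQUENESS FOR THE DRAIN-FREE INITIAL-VALUE PROBLEM AT `0⁻`.**  For `s > 1`, two solutions of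
`b' = (4/s²) b(t/s)²` on `t < 0`, continuous on `(−∞, 0]`, bounded there, with the same value at `0`,
coincide on `(−∞, 0]`.  (So a drain-free front is determined by `b(0⁻)`, i.e. — by the scaling symmetry
`b ↦ c·b(c·)` — drain-free fronts at a given time ratio are unique up to scaling; at `s = 2` it is the relay
profile `e^{t}` of `…RelayProfile`.)
[cite: Tao2016AveragedNS, §1.2 (dyadic model); cell vocabulary (drain-free scalar front equation of `DyadicScalarFronts` at `Λ = ∞`; programme R-glob, step G0, of the census of stmt-21808)] -/
theorem drainfree_ivp_unique (hs : 1 < s)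
    (hc₁ : ContinuousOn b₁ (Iic 0)) (hc₂ : ContinuousOn b₂ (Iic 0))
    (hd₁ : ∀ t : ℝ, t < 0 → HasDerivAt b₁ (4 / s ^ 2 * b₁ (t / s) ^ 2) t)
    (hd₂ : ∀ t : ℝ, t < 0 → HasDerivAt b₂ (4 / s ^ 2 * b₂ (t / s) ^ 2) t)
    (hB₁ : ∀ t : ℝ, t ≤ 0 → |b₁ t| ≤ B) (hB₂ : ∀ t : ℝ, t ≤ 0 → |b₂ t| ≤ B) (h0 : b₁ 0 = b₂ 0) :
    ∀ t : ℝ, t ≤ 0 → b₁ t = b₂ t := by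
  have hB : 0 ≤ B := (abs_nonneg _).trans (hB₁ 0 le_rfl)
  have hτ₀ : 0 < s ^ 2 / (16 * (B + 1)) := by positivity
  intro t ht
  obtain ⟨n, hn⟩ := pow_unbounded_of_one_lt (-t / (s ^ 2 / (16 * (B + 1)))) hs
  refine drainfree_eq_pow hs hB hc₁ hc₂ hd₁ hd₂ hB₁ hB₂ h0 n t ⟨?_, ht⟩
  rw [div_lt_iff₀ hτ₀] at hn
  linarith

end WakeRatchetRelayDrainFreeUnique

end Summit.NavierStokesRegularity.NavierStokesRegularity.Theorems

end
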